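import Summits.CriticalPhenomena.CardyFormulaZ2.Theorems.CardyComplexConeEdgePrecompactUFRSTwoArcCore
import Summits.CriticalPhenomena.CardyFormulaZ2.Theorems.CardyComplexConeEdgePrecompactUFRSTwoArcClosing

set_option linter.unusedVariables false

/-!
# Two orbit stretches with common first and last corner, closable inside a disc: the winding jump
(line `qkz-strip-boundary-arm` of crux `CardyComplexCone.EdgePrecompact`, stmt-CriticalPhenomena-11387;
third file of the planar input `medialTwoArcSurround_ball` of the residual `ufrs_slippedReturnCase_cert(J)`)

Two injective orbit stretches `O₀ c [0, n₀]` (dynamics `β₀`) and `O₁ c [0, n₁]` (dynamics `β₁`) from the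
same corner `c` with the same last corner, whose corners `O c i`, `1 ≤ i ≤ n`, all lie strictly
farther (potential `pot a b ∘ cpos`, `…TwoArcClosing.lean`) from a face centre `(a/2, b/2)` than both
the first medial vertex `cpos c` and the vertex after the last corner: `twoArc_dartWnd_ne_SR` — if the
turn sums `∑ turnSign` of the two stretches differ, then their `dartWnd`-sums differ at one of the two
faces of the first dart. Proof: close both coded arcs by ONE dart path inside the disc
(`exists_dartPath_le_pot_SR`), glue (`glueSeq`, `isTrail_glue_SR`: the two closed vertex lists are
trails of the oriented medial graph) and apply the closable open-arc Umlaufsatz `twoTrail_turn_sub_SR`.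

References: H. Hopf, Compositio Math. 2 (1935), Satz I; S. Smirnov, Ann. of Math. 172 (2010), §4.
-/

namespace Summit.CriticalPhenomena.CardyFormulaZ2.Cruxes.EdgePrecompact.QkzStripBoundaryArm

open Literature.Probability.LatticeModels Literature.Probability.Percolation
open Literature.Probability.LatticeModels.MedialTrail

/-! ## Gluing an arc and a closing path into a periodic sequence -/

/-- The arc `P 0, …, P (n + 1)` followed by the closing path `K 1, …, K M` (`K 0 = P (n + 1)`,
`K M = P 0`) and then by `P 1, P 2, …`: a sequence of period `n + 1 + M` through the closed walk. -/
def glueSeq (P : ℕ → Pt) (n : ℕ) (K : ℕ → Pt) (M : ℕ) (m : ℕ) : Pt :=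
  if m ≤ n + 1 then P m else if m ≤ n + 1 + M then K (m - (n + 1)) else P (m - (n + 1 + M))

variable {P : ℕ → Pt} {n : ℕ} {K : ℕ → Pt} {M : ℕ}

/-- On the arc. -/
theorem glueSeq_of_le_SR {m : ℕ} (hm : m ≤ n + 1) : glueSeq P n K M m = P m := by
  unfold glueSeq; rw [if_pos hm]

/-- On the closing path. -/
theorem glueSeq_path_SR (hK0 : K 0 = P (n + 1)) {u : ℕ} (hu : u ≤ M) : glueSeq P n K M (n + 1 + u) = K u := by
  unfold glueSeq
  rcases Nat.eq_zero_or_pos u with rfl | hu0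
  · rw [if_pos (by omega), hK0]
  · rw [if_neg (by omega), if_pos (by omega)]; congr 1; omega

/-- The period. -/
theorem glueSeq_period_SR (hK0 : K 0 = P (n + 1)) (hKM : K M = P 0) : glueSeq P n K M (n + (M + 1)) = glueSeq P n K M 0 := by
  rw [show n + (M + 1) = n + 1 + M by ring, glueSeq_path_SR hK0 le_rfl, hKM, glueSeq_of_le_SR (by omega)]

/-- One past the period. -/
theorem glueSeq_period_succ_SR : glueSeq P n K M (n + (M + 1) + 1) = glueSeq P n K M 1 := by
  unfold glueSeq
  rw [if_neg (by omega), if_neg (by omega), if_pos (by omega)]; congr 1; omega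

/-- The darts of the glued sequence. -/
theorem glueSeq_dart_SR (hK0 : K 0 = P (n + 1)) (m : ℕ) (hm : m < n + (M + 1)) :
    (m ≤ n ∧ (glueSeq P n K M m, glueSeq P n K M (m + 1)) = (P m, P (m + 1))) ∨
      (∃ u < M, m = n + 1 + u ∧ (glueSeq P n K M m, glueSeq P n K M (m + 1)) = (K u, K (u + 1))) := by
  rcases Nat.lt_or_ge n m with h | h
  · right
    obtain ⟨u, rfl⟩ : ∃ u, m = n + 1 + u := ⟨m - (n + 1), by omega⟩
    refine ⟨u, by omega, rfl, ?_⟩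
    rw [glueSeq_path_SR hK0 (show u ≤ M by omega), add_assoc, glueSeq_path_SR hK0 (show u + 1 ≤ M by omega)]
  · left
    exact ⟨h, by rw [glueSeq_of_le_SR (by omega), glueSeq_of_le_SR (by omega)]⟩

/-- **The glued closed walk is a trail** when the arc darts are darts and pairwise distinct, the path
darts are darts with pairwise distinct tails, and no arc dart is a path dart. -/
theorem isTrail_glue_SR (hP : ∀ m ≤ n, IsDart (P m) (P (m + 1))) (hK : ∀ u < M, IsDart (K u) (K (u + 1)))
    (hK0 : K 0 = P (n + 1)) (hKM : K M = P 0)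
    (hPinj : ∀ m ≤ n, ∀ m' ≤ n, (P m, P (m + 1)) = (P m', P (m' + 1)) → m = m')
    (hKinj : ∀ u ≤ M, ∀ u' ≤ M, K u = K u' → u = u')
    (hsep : ∀ m ≤ n, ∀ u < M, (P m, P (m + 1)) ≠ (K u, K (u + 1))) :
    IsTrail ((List.range (n + (M + 1))).map (glueSeq P n K M)) := by
  have hper := glueSeq_period_SR hK0 hKM
  refine ⟨by simp, ?_, ?_⟩
  · rw [cdarts_map_range _ hper]
    refine List.Nodup.map_on ?_ (List.nodup_range)
    intro m hm m' hm' hmm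
    rw [List.mem_range] at hm hm'
    rcases glueSeq_dart_SR hK0 m hm with ⟨h1, e1⟩ | ⟨u, hu, rfl, e1⟩ <;>
    rcases glueSeq_dart_SR hK0 m' hm' with ⟨h2, e2⟩ | ⟨u', hu', rfl, e2⟩
    · exact hPinj m h1 m' h2 (by rw [← e1, ← e2, hmm])
    · exact absurd (by rw [← e1, ← e2, hmm]) (hsep m h1 u' hu')
    · exact absurd (by rw [← e1, ← e2, hmm]) (hsep m' h2 u hu)
    · have : u = u' := hKinj u hu.le u' hu'.le (by
        have := congrArg Prod.fst (e1.symm.trans (hmm.trans e2)); exact this)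
      rw [this]
  · rw [cdarts_map_range _ hper]
    intro d hd
    rw [List.mem_map] at hd
    obtain ⟨m, hm, rfl⟩ := hd
    rw [List.mem_range] at hm
    rcases glueSeq_dart_SR hK0 m hm with ⟨h1, e1⟩ | ⟨u, hu, rfl, e1⟩
    · rw [e1]; exact hP m h1
    · rw [e1]; exact hK u hu

/-! ## Coded orbit stretches -/

/-- Distinct corners of an orbit give distinct coded darts. -/
theorem cornerOrbit_eq_of_cpos_dart_eq_SR (β : BondConfig (Site 2)) (c : Site 2 × Fin 4) (m m' : ℕ)
    (h : (cpos (cornerOrbit β c m), cpos (cornerOrbit β c (m + 1))) =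
      (cpos (cornerOrbit β c m'), cpos (cornerOrbit β c (m' + 1)))) :
    cornerOrbit β c m = cornerOrbit β c m' := by
  simp only [Prod.mk.injEq] at h
  obtain ⟨h1, h2⟩ := h
  change cpos (nextCorner β (cornerOrbit β c m)) = cpos (nextCorner β (cornerOrbit β c m')) at h2
  rw [cpos_nextCorner, cpos_nextCorner, h1, Prod.mk.injEq] at h2
  have hk : (cornerOrbit β c m).2 = (cornerOrbit β c m').2 :=
    cdir_injective (Prod.ext (by omega) (by omega))
  exact eq_of_cpos_eq h1 hk

/-- The coded point after a corner does not depend on the dynamics. -/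
theorem cpos_cornerOrbit_succ_eq_SR {β₀ β₁ : BondConfig (Site 2)} {c : Site 2 × Fin 4} {n₀ n₁ : ℕ}
    (h : cornerOrbit β₀ c n₀ = cornerOrbit β₁ c n₁) :
    cpos (cornerOrbit β₀ c (n₀ + 1)) = cpos (cornerOrbit β₁ c (n₁ + 1)) := by
  change cpos (nextCorner β₀ (cornerOrbit β₀ c n₀)) = cpos (nextCorner β₁ (cornerOrbit β₁ c n₁))
  rw [cpos_nextCorner, cpos_nextCorner, h]

/-- **Two orbit stretches with common first and last corner, closable inside a disc, with different
turn sums have different winding contributions at a face of their first dart** (registered anchor).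
DATA: dynamics `β₀`, `β₁`; corner `c`; lengths `n₀, n₁ ≥ 1`; a face centre `(a/2, b/2)`, `a`, `b`
odd; both stretches injective; `O₀ c n₀ = O₁ c n₁`; every corner `O c i`, `1 ≤ i ≤ n`, of either
stretch has coded potential `(2x - a)² + (2y - b)²` strictly larger than that of `cpos c` and of the
coded point after the last corner (the arcs stay outside a disc containing the two loose ends);
`∑_{i<n₀} turnSign β₀ (O₀ c i) ≠ ∑_{j<n₁} turnSign β₁ (O₁ c j)`. CONCLUSION: for `F` the left or the
right face of the first coded dart `cpos c → cpos (O₀ c 1)`, the sums `∑_{i<n} dartWnd (cpos (O c i),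
cpos (O c (i+1))) F` of the two stretches differ. -/
theorem twoArc_dartWnd_ne_SR : ∀ (β₀ β₁ : BondConfig (Site 2)) (c : Site 2 × Fin 4) (n₀ n₁ : ℕ) (a b : ℤ), a % 2 = 1 → b % 2 = 1 → 1 ≤ n₀ → 1 ≤ n₁ → (∀ i j : ℕ, i ≤ n₀ → j ≤ n₀ → cornerOrbit β₀ c i = cornerOrbit β₀ c j → i = j) → (∀ i j : ℕ, i ≤ n₁ → j ≤ n₁ → cornerOrbit β₁ c i = cornerOrbit β₁ c j → i = j) → cornerOrbit β₀ c n₀ = cornerOrbit β₁ c n₁ → (∀ i, 1 ≤ i → i ≤ n₀ → max ((2 * (cpos c).1 - a) ^ 2 + (2 * (cpos c).2 - b) ^ 2) ((2 * (cpos (cornerOrbit β₀ c (n₀ + 1))).1 - a) ^ 2 + (2 * (cpos (cornerOrbit β₀ c (n₀ + 1))).2 - b) ^ 2) < (2 * (cpos (cornerOrbit β₀ c i)).1 - a) ^ 2 + (2 * (cpos (cornerOrbit β₀ c i)).2 - b) ^ 2) → (∀ j, 1 ≤ j → j ≤ n₁ → max ((2 * (cpos c).1 - a) ^ 2 + (2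 * (cpos c).2 - b) ^ 2) ((2 * (cpos (cornerOrbit β₀ c (n₀ + 1))).1 - a) ^ 2 + (2 * (cpos (cornerOrbit β₀ c (n₀ + 1))).2 - b) ^ 2) < (2 * (cpos (cornerOrbit β₁ c j)).1 - a) ^ 2 + (2 * (cpos (cornerOrbit β₁ c j)).2 - b) ^ 2) → ∑ i ∈ Finset.range n₀, turnSign β₀ (cornerOrbit β₀ c i) ≠ ∑ j ∈ Finset.range n₁, turnSign β₁ (cornerOrbit β₁ c j) → ∃ F : MedialTrail.Pt, (F = MedialTrail.lf (cpos c, cpos (cornerOrbit β₀ c 1)) ∨ F = MedialTrail.rf (cpos c, cpos (cornerOrbit β₀ c 1))) ∧ ∑ i ∈ Finset.range n₀, MedialTrail.dartWnd (cpos (cornerOrbit β₀ c i), cpos (cornerOrbit β₀ c (i + 1))) F ≠ ∑ j ∈ Finset.range n₁, MedialTrail.dartWnd (cpos (cornerOrbit β₁ c j), cpos (cornerOrbit β₁ c (j + 1))) F := by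
  intro β₀ β₁ c n₀ n₁ a b ha hb hn₀ hn₁ hinj₀ hinj₁ hend hfar₀ hfar₁ hturn
  set P₀ : ℕ → Pt := fun m => cpos (cornerOrbit β₀ c m) with hP₀
  set P₁ : ℕ → Pt := fun m => cpos (cornerOrbit β₁ c m) with hP₁
  set p : Pt := P₀ (n₀ + 1) with hp
  set q : Pt := cpos c with hq
  obtain ⟨K, M, hK0, hKM, hKd, hKinj, hKpot⟩ := exists_dartPath_le_pot_SR a b p q ha hb
  have hq₀ : P₀ 0 = q := rfl
  have hq₁ : P₁ 0 = q := rfl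
  have hp₁ : P₁ (n₁ + 1) = p := (cpos_cornerOrbit_succ_eq_SR hend).symm
  have h1 : P₀ 1 = P₁ 1 := cpos_cornerOrbit_succ_eq_SR (n₀ := 0) (n₁ := 0) rfl
  -- the two trails
  have sep : ∀ (P : ℕ → Pt) (n : ℕ), 1 ≤ n → P 0 = q →
      (∀ i, 1 ≤ i → i ≤ n → max (pot a b q) (pot a b p) < pot a b (P i)) →
      ∀ m ≤ n, ∀ u < M, (P m, P (m + 1)) ≠ (K u, K (u + 1)) := by
    intro P n hn hP0 hfar m hm u hu h
    simp only [Prod.mk.injEq] at h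
    rcases Nat.eq_zero_or_pos m with rfl | hm0
    · have := hfar 1 le_rfl hn
      have := hKpot (u + 1) (by omega)
      rw [← h.2] at this
      change pot a b (P (0 + 1)) ≤ max (pot a b p) (pot a b q) at this
      rw [zero_add, max_comm] at this
      omega
    · have := hfar m hm0 hm
      have := hKpot u hu.le
      rw [← h.1] at this
      change pot a b (P m) ≤ max (pot a b p) (pot a b q) at this
      rw [max_comm] at this
      omega
  have T₀ : IsTrail ((List.range (n₀ + (M + 1))).map (glueSeq P₀ n₀ K M)) :=
    isTrail_glue_SR (fun m _ => isDart_cpos β₀ _) hKd hK0 hKM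
      (fun m hm m' hm' h => hinj₀ m m' hm hm' (cornerOrbit_eq_of_cpos_dart_eq_SR β₀ c m m' h))
      hKinj (sep P₀ n₀ hn₀ hq₀ fun i hi hi' => hfar₀ i hi hi')
  have T₁ : IsTrail ((List.range (n₁ + (M + 1))).map (glueSeq P₁ n₁ K M)) :=
    isTrail_glue_SR (fun m _ => isDart_cpos β₁ _) hKd (hK0.trans hp₁.symm) (hKM.trans hq₁.symm)
      (fun m hm m' hm' h => hinj₁ m m' hm hm' (cornerOrbit_eq_of_cpos_dart_eq_SR β₁ c m m' h))
      hKinj (sep P₁ n₁ hn₁ hq₁ fun i hi hi' => hfar₁ i hi hi')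
  -- the closable open-arc Umlaufsatz
  have key := twoTrail_turn_sub_SR (glueSeq P₀ n₀ K M) (glueSeq P₁ n₁ K M) n₀ n₁ (M + 1) (by omega) T₀ T₁
    (glueSeq_period_SR hK0 hKM) glueSeq_period_succ_SR
    (glueSeq_period_SR (hK0.trans hp₁.symm) (hKM.trans hq₁.symm)) glueSeq_period_succ_SR
    (by rw [glueSeq_of_le_SR (by omega), glueSeq_of_le_SR (by omega)]; rfl)
    (by rw [glueSeq_of_le_SR (by omega), glueSeq_of_le_SR (by omega), h1])
    (by
      intro u hu
      rcases Nat.lt_or_ge u 2 with hu2 | hu2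
      · interval_cases u
        · rw [glueSeq_of_le_SR (by omega), glueSeq_of_le_SR (by omega)]; exact congrArg cpos hend
        · rw [glueSeq_of_le_SR (by omega), glueSeq_of_le_SR (by omega)]; exact hp₁.symm
      rcases Nat.lt_or_ge u (M + 2) with hu3 | hu3
      · rw [show n₀ + u = n₀ + 1 + (u - 1) by omega, show n₁ + u = n₁ + 1 + (u - 1) by omega,
          glueSeq_path_SR hK0 (by omega), glueSeq_path_SR (hK0.trans hp₁.symm) (by omega)]
      · rw [show n₀ + u = n₀ + (M + 1) + 1 by omega, show n₁ + u = n₁ + (M + 1) + 1 by omega,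
          glueSeq_period_succ_SR, glueSeq_period_succ_SR, glueSeq_of_le_SR (by omega),
          glueSeq_of_le_SR (by omega), h1])
  -- read the arcs off the glued sequences
  have rt : ∀ (β : BondConfig (Site 2)) (P : ℕ → Pt) (n : ℕ), (P = fun m => cpos (cornerOrbit β c m)) →
      ∑ m ∈ Finset.range n, turn (glueSeq P n K M m) (glueSeq P n K M (m + 1)) (glueSeq P n K M (m + 2)) =
        ∑ m ∈ Finset.range n, turnSign β (cornerOrbit β c m) := by
    intro β P n hP
    refine Finset.sum_congr rfl fun m hm => ?_
    rw [Finset.mem_range] at hm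
    rw [glueSeq_of_le_SR (by omega), glueSeq_of_le_SR (by omega), glueSeq_of_le_SR (by omega), hP]
    exact turn_cpos β _
  have rw_ : ∀ (P : ℕ → Pt) (n : ℕ) (F : Pt),
      ∑ m ∈ Finset.range n, dartWnd (glueSeq P n K M m, glueSeq P n K M (m + 1)) F =
        ∑ m ∈ Finset.range n, dartWnd (P m, P (m + 1)) F := by
    intro P n F
    refine Finset.sum_congr rfl fun m hm => ?_
    rw [Finset.mem_range] at hm
    rw [glueSeq_of_le_SR (by omega), glueSeq_of_le_SR (by omega)]
  rw [rt β₀ P₀ n₀ rfl, rt β₁ P₁ n₁ rfl, rw_, rw_, rw_, rw_, glueSeq_of_le_SR (by omega),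
    glueSeq_of_le_SR (by omega)] at key
  have hne : (∑ m ∈ Finset.range n₀, dartWnd (P₀ m, P₀ (m + 1)) (lf (P₀ 0, P₀ 1)) -
        ∑ m ∈ Finset.range n₁, dartWnd (P₁ m, P₁ (m + 1)) (lf (P₀ 0, P₀ 1))) +
      (∑ m ∈ Finset.range n₀, dartWnd (P₀ m, P₀ (m + 1)) (rf (P₀ 0, P₀ 1)) -
        ∑ m ∈ Finset.range n₁, dartWnd (P₁ m, P₁ (m + 1)) (rf (P₀ 0, P₀ 1))) ≠ 0 := by
    intro h0; rw [h0, mul_zero, sub_eq_zero] at key; exact hturn key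
  by_cases hL : ∑ m ∈ Finset.range n₀, dartWnd (P₀ m, P₀ (m + 1)) (lf (P₀ 0, P₀ 1)) =
      ∑ m ∈ Finset.range n₁, dartWnd (P₁ m, P₁ (m + 1)) (lf (P₀ 0, P₀ 1))
  · refine ⟨rf (P₀ 0, P₀ 1), Or.inr rfl, fun hR => hne ?_⟩
    change ∑ m ∈ Finset.range n₀, dartWnd (P₀ m, P₀ (m + 1)) (rf (P₀ 0, P₀ 1)) =
      ∑ m ∈ Finset.range n₁, dartWnd (P₁ m, P₁ (m + 1)) (rf (P₀ 0, P₀ 1)) at hR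
    rw [hL, hR]; ring
  · exact ⟨lf (P₀ 0, P₀ 1), Or.inl rfl, hL⟩

end Summit.CriticalPhenomena.CardyFormulaZ2.Cruxes.EdgePrecompact.QkzStripBoundaryArm
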